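import Summits.KontsevichZagierPeriods.KontsevichZagierPeriods.Theorems.NormalFormPrinciple.Negative.ArctanWitness
import Literature.NumberTheory.Transcendental.KZProductIdeal

/-!
# Crux `HurwitzMicroSectors.NormalFormPrinciple` (stmt-KontsevichZagierPeriods-3869) — negative side IV:
the transposition bridge (scope of the no-rule-2 witness)

Landed copy of §4.3b of `Cruxes/NormalFormPrinciple/Disproof.lean` (cdisprove, 2026-08-16): the
arctangent reflection pair of `ArctanWitness.lean` (not CoV-free-related) IS connected by two
Newton–Leibniz moves and ONE coordinate transposition (`arctan_pair_mem_closure_nl_swap`): bridge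
`A = [[−1,0]×[0,1], k(s−t)]`, `k = K'`, `K(u) = u` (`u ≤ 1`), `(u−1) + 1/(1+(u−1)²)` (`u ≥ 1`),
`K(x+1) − K(x) = 1/(1+x²)`; moves: rule 3) in `s`, the swap (rule 2), rule 3) in `t`. So the pair is
KZ-equivalent (`arctan_pair_equivalent`): an instance of [Ayoub2015, Rem. 1.5].
-/

noncomputable section

set_option linter.dupNamespace false

open MeasureTheory Set intervalIntegral
open Literature.NumberTheory.Transcendental Literature.NumberTheory.Transcendental.KZ
open Literature.ModelTheory.ExponentialFields (IsSemialgebraic)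

namespace Summit.KontsevichZagierPeriods.HurwitzMicroSectors.NormalFormPrinciple.Negative

/-! ### §4.3b The no-rule-2 witness is reconnected by two Newton–Leibniz moves and ONE transposition -/

section Swap

/-- The C¹ difference-equation solution `K`: `K(u) = u` on `u ≤ 1`, `K(u) = (u−1) + 1/(1+(u−1)²)`
on `u ≥ 1`; it satisfies `K(x+1) − K(x) = 1/(1+x²)` for `x ∈ [0,1]`. -/
def Kfun (u : ℝ) : ℝ := if u ≤ 1 then u else (u - 1) + (1 + (u - 1) ^ 2)⁻¹

/-- Its derivative `k = K'`: `1` on `u ≤ 1`, `1 − 2(u−1)/(1+(u−1)²)²` on `u ≥ 1` (continuous at `1`). -/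
def kfun (u : ℝ) : ℝ := if u ≤ 1 then 1 else 1 + (-(2 * (u - 1)) / (1 + (u - 1) ^ 2) ^ 2)

/-- `1 + y² > 0`. -/
theorem one_add_sq_pos (y : ℝ) : 0 < 1 + y ^ 2 := by positivity

/-- Derivative of the rational piece `u ↦ (u−1) + 1/(1+(u−1)²)`. -/
theorem hasDerivAt_ratPiece (u : ℝ) :
    HasDerivAt (fun u : ℝ => (u - 1) + (1 + (u - 1) ^ 2)⁻¹)
      (1 + (-(2 * (u - 1)) / (1 + (u - 1) ^ 2) ^ 2)) u := by
  have hq : HasDerivAt (fun u : ℝ => 1 + (u - 1) ^ 2) (2 * (u - 1)) u := by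
    have h := (((hasDerivAt_id u).sub_const 1).pow 2).const_add 1
    have e : (2 * (u - 1) : ℝ) = ↑(2:ℕ) * (id u - 1) ^ (2 - 1) * 1 := by simp
    rw [e]
    exact h
  exact ((hasDerivAt_id u).sub_const 1).add (hq.inv (one_add_sq_pos (u - 1)).ne')

/-- `K' = k` everywhere (C¹ junction at `u = 1`: both one-sided derivatives equal `1`). -/
theorem hasDerivAt_Kfun (u : ℝ) : HasDerivAt Kfun (kfun u) u := by
  unfold Kfun kfun
  rcases lt_trichotomy u 1 with hu | rfl | hu
  · have hev : (fun u : ℝ => if u ≤ 1 then u else (u - 1) + (1 + (u - 1) ^ 2)⁻¹) =ᶠ[nhds u] id := by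
      filter_upwards [Iio_mem_nhds hu] with v hv
      have hv' : v < 1 := hv
      simp [hv'.le]
    rw [if_pos hu.le]
    exact (hasDerivAt_id u).congr_of_eventuallyEq hev
  · rw [if_pos le_rfl]
    have hleft : HasDerivWithinAt (fun u : ℝ => if u ≤ 1 then u else (u - 1) + (1 + (u - 1) ^ 2)⁻¹)
        1 (Iic 1) 1 :=
      ((hasDerivAt_id (1:ℝ)).hasDerivWithinAt (s := Iic 1)).congr
        (fun v hv => by simp [show v ≤ 1 from hv]) (by simp)
    have hright : HasDerivWithinAt (fun u : ℝ => if u ≤ 1 then u else (u - 1) + (1 + (u - 1) ^ 2)⁻¹)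
        1 (Ici 1) 1 := by
      have h := (hasDerivAt_ratPiece 1).hasDerivWithinAt (s := Ici 1)
      simp only [sub_self, mul_zero, neg_zero, zero_div, add_zero] at h
      refine h.congr (fun v hv => ?_) (by simp)
      by_cases hv1 : v ≤ 1
      · have : v = 1 := le_antisymm hv1 hv
        subst this; simp
      · simp [hv1]
    have := hleft.union hright
    rw [Iic_union_Ici] at this
    exact this.hasDerivAt Filter.univ_mem
  · have hev : (fun u : ℝ => if u ≤ 1 then u else (u - 1) + (1 + (u - 1) ^ 2)⁻¹) =ᶠ[nhds u]
        fun u => (u - 1) + (1 + (u - 1) ^ 2)⁻¹ := by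
      filter_upwards [Ioi_mem_nhds hu] with v hv
      have hv' : 1 < v := hv
      simp [not_le.mpr hv']
    rw [if_neg (not_le.mpr hu)]
    exact (hasDerivAt_ratPiece u).congr_of_eventuallyEq hev

/-- `K` is continuous (the pieces agree at `u = 1`). -/
theorem continuous_Kfun : Continuous Kfun := by
  unfold Kfun
  refine Continuous.if_le continuous_id ?_ continuous_id continuous_const ?_
  · exact (continuous_id.sub continuous_const).add
      ((continuous_const.add ((continuous_id.sub continuous_const).pow 2)).inv₀
        fun u => (one_add_sq_pos (u - 1)).ne')
  · intro u hu; simp [hu]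

/-- `k` is continuous (the pieces agree at `u = 1`). -/
theorem continuous_kfun : Continuous kfun := by
  unfold kfun
  refine Continuous.if_le continuous_const ?_ continuous_id continuous_const ?_
  · refine continuous_const.add (Continuous.div ?_ ?_ fun u => ?_)
    · fun_prop
    · fun_prop
    · exact (pow_pos (one_add_sq_pos (u - 1)) 2).ne'
  · intro u hu; simp [hu]

/-- The functional equation `K(x+1) − K(x) = 1/(1+x²)` on `[0,1]`. -/
theorem Kfun_add_one_sub (x : ℝ) (h0 : 0 ≤ x) (h1 : x ≤ 1) : Kfun (x + 1) - Kfun x = 1 / (1 + x ^ 2) := by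
  unfold Kfun
  rw [if_pos h1]
  by_cases hx : x + 1 ≤ 1
  · have hx0 : x = 0 := le_antisymm (by linarith) h0
    subst hx0; simp
  · rw [if_neg hx]
    have : (x + 1 - 1 : ℝ) = x := by ring
    rw [this, one_div]
    ring

/-! #### The two-dimensional representation `A = [[−1,0]×[0,1], k(s − t)]` (coordinates `(t,s)`) -/

/-- The rectangle `[−1,0] × [0,1] ⊂ ℝ²` (first coordinate `t`, last coordinate `s`). -/
def rectTS : Set (Fin 2 → ℝ) := {z | z 0 ∈ Icc (-1:ℝ) 0 ∧ z 1 ∈ Icc (0:ℝ) 1}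

/-- Polynomial (in)equalities in `ℝ²` are `ℚ`-semialgebraic — the four faces and the diagonal cut. -/
theorem isSemialgebraic_rectTS : IsSemialgebraic ℚ rectTS := by
  have h1 := Literature.ModelTheory.ExponentialFields.isSemialgebraic_setOf_eval_le (k := ℚ) (R := ℝ)
    (MvPolynomial.C (-1) : MvPolynomial (Fin 2) ℚ) (MvPolynomial.X 0)
  have h2 := Literature.ModelTheory.ExponentialFields.isSemialgebraic_setOf_eval_le (k := ℚ) (R := ℝ)
    (MvPolynomial.X 0 : MvPolynomial (Fin 2) ℚ) 0
  have h3 := Literature.ModelTheory.ExponentialFields.isSemialgebraic_setOf_eval_le (k := ℚ) (R := ℝ)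
    (0 : MvPolynomial (Fin 2) ℚ) (MvPolynomial.X 1)
  have h4 := Literature.ModelTheory.ExponentialFields.isSemialgebraic_setOf_eval_le (k := ℚ) (R := ℝ)
    (MvPolynomial.X 1 : MvPolynomial (Fin 2) ℚ) 1
  simp only [MvPolynomial.aeval_X, map_zero, map_one, map_neg] at h1 h2 h3 h4
  have hset : rectTS = (({z : Fin 2 → ℝ | (-1:ℝ) ≤ z 0} ∩ {z | z 0 ≤ 0}) ∩ {z | (0:ℝ) ≤ z 1}) ∩ {z | z 1 ≤ 1} := by
    ext z; simp [rectTS, mem_Icc, and_assoc]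
  rw [hset]
  exact ((h1.inter h2).inter h3).inter h4

/-- The half-plane `z i − z j ≤ 1` is `ℚ`-semialgebraic. -/
theorem isSemialgebraic_diag_le (i j : Fin 2) : IsSemialgebraic ℚ {z : Fin 2 → ℝ | z i - z j ≤ 1} := by
  have h := Literature.ModelTheory.ExponentialFields.isSemialgebraic_setOf_eval_le (k := ℚ) (R := ℝ)
    (MvPolynomial.X i - MvPolynomial.X j : MvPolynomial (Fin 2) ℚ) 1
  simpa using h

/-- The half-plane `z i − z j ≥ 1` is `ℚ`-semialgebraic. -/
theorem isSemialgebraic_diag_ge (i j : Fin 2) : IsSemialgebraic ℚ {z : Fin 2 → ℝ | 1 ≤ z i - z j} := by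
  have h := Literature.ModelTheory.ExponentialFields.isSemialgebraic_setOf_eval_le (k := ℚ) (R := ℝ)
    (1 : MvPolynomial (Fin 2) ℚ) (MvPolynomial.X i - MvPolynomial.X j)
  simpa using h

/-- `z ↦ K(z i − z j)` is `ℚ`-semialgebraic (piecewise rational, glued along `z i − z j = 1`). -/
theorem isSemialgebraicFunOn_Kfun_comp {s : Set (Fin 2 → ℝ)} (hs : IsSemialgebraic ℚ s) (i j : Fin 2) :
    IsSemialgebraicFunOn ℚ s (fun z => Kfun (z i - z j)) := by
  have hA : IsSemialgebraicFunOn ℚ (s ∩ {z : Fin 2 → ℝ | z i - z j ≤ 1}) (fun z => z i - z j) := by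
    have := isSemialgebraicFunOn_aeval (hs.inter (isSemialgebraic_diag_le i j))
      (MvPolynomial.X i - MvPolynomial.X j : MvPolynomial (Fin 2) ℚ)
    exact this.congr fun z _ => by simp
  have hB : IsSemialgebraicFunOn ℚ (s ∩ {z : Fin 2 → ℝ | 1 ≤ z i - z j})
      (fun z => (z i - z j - 1) + (1 + (z i - z j - 1) ^ 2)⁻¹) := by
    set u : MvPolynomial (Fin 2) ℚ := MvPolynomial.X i - MvPolynomial.X j - 1 with hu
    have hq : ∀ z ∈ s ∩ {z : Fin 2 → ℝ | 1 ≤ z i - z j}, MvPolynomial.aeval z (1 + u ^ 2) ≠ 0 := by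
      intro z _
      have : (0:ℝ) < 1 + (z i - z j - 1) ^ 2 := one_add_sq_pos _
      simp only [hu, map_add, map_one, map_pow, map_sub, MvPolynomial.aeval_X]
      exact this.ne'
    have := isSemialgebraicFunOn_aeval_div_aeval (hs.inter (isSemialgebraic_diag_ge i j))
      (u * (1 + u ^ 2) + 1) (1 + u ^ 2) hq
    refine this.congr fun z _ => ?_
    have hpos : (1 + (z i - z j - 1) ^ 2 : ℝ) ≠ 0 := (one_add_sq_pos _).ne'
    simp only [hu, map_add, map_one, map_pow, map_sub, map_mul, MvPolynomial.aeval_X]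
    field_simp
  have hunion : s = (s ∩ {z : Fin 2 → ℝ | z i - z j ≤ 1}) ∪ (s ∩ {z : Fin 2 → ℝ | 1 ≤ z i - z j}) := by
    rw [← inter_union_distrib_left]
    refine (inter_eq_left.mpr fun z _ => ?_).symm
    exact (le_total (z i - z j) 1).imp id id
  rw [hunion]
  refine IsSemialgebraicFunOn.union hA hB (fun z hz => ?_) (fun z hz => ?_)
  · have : z i - z j ≤ 1 := hz.2
    simp [Kfun, this]
  · have h1 : 1 ≤ z i - z j := hz.2
    by_cases h : z i - z j ≤ 1
    · have heq : z i - z j = 1 := le_antisymm h h1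
      simp [Kfun, heq]
    · simp [Kfun, h]

/-- `z ↦ k(z i − z j)` is `ℚ`-semialgebraic (piecewise rational, glued along `z i − z j = 1`). -/
theorem isSemialgebraicFunOn_kfun_comp {s : Set (Fin 2 → ℝ)} (hs : IsSemialgebraic ℚ s) (i j : Fin 2) :
    IsSemialgebraicFunOn ℚ s (fun z => kfun (z i - z j)) := by
  have hA : IsSemialgebraicFunOn ℚ (s ∩ {z : Fin 2 → ℝ | z i - z j ≤ 1}) (fun _ => ((1:ℚ) : ℝ)) :=
    isSemialgebraicFunOn_ratCast (hs.inter (isSemialgebraic_diag_le i j)) 1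
  have hB : IsSemialgebraicFunOn ℚ (s ∩ {z : Fin 2 → ℝ | 1 ≤ z i - z j})
      (fun z => 1 + (-(2 * (z i - z j - 1)) / (1 + (z i - z j - 1) ^ 2) ^ 2)) := by
    set u : MvPolynomial (Fin 2) ℚ := MvPolynomial.X i - MvPolynomial.X j - 1 with hu
    have hq : ∀ z ∈ s ∩ {z : Fin 2 → ℝ | 1 ≤ z i - z j}, MvPolynomial.aeval z ((1 + u ^ 2) ^ 2) ≠ 0 := by
      intro z _
      have : (0:ℝ) < (1 + (z i - z j - 1) ^ 2) ^ 2 := pow_pos (one_add_sq_pos _) 2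
      simp only [hu, map_add, map_one, map_pow, map_sub, MvPolynomial.aeval_X]
      exact this.ne'
    have := isSemialgebraicFunOn_aeval_div_aeval (hs.inter (isSemialgebraic_diag_ge i j))
      ((1 + u ^ 2) ^ 2 - 2 * u) ((1 + u ^ 2) ^ 2) hq
    refine this.congr fun z _ => ?_
    have hpos : ((1 + (z i - z j - 1) ^ 2) ^ 2 : ℝ) ≠ 0 := (pow_pos (one_add_sq_pos _) 2).ne'
    simp only [hu, map_add, map_one, map_pow, map_sub, map_mul, MvPolynomial.aeval_X, map_ofNat]
    field_simp
    ring
  have hunion : s = (s ∩ {z : Fin 2 → ℝ | z i - z j ≤ 1}) ∪ (s ∩ {z : Fin 2 → ℝ | 1 ≤ z i - z j}) := by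
    rw [← inter_union_distrib_left]
    refine (inter_eq_left.mpr fun z _ => ?_).symm
    exact (le_total (z i - z j) 1).imp id id
  rw [hunion]
  refine IsSemialgebraicFunOn.union hA hB (fun z hz => ?_) (fun z hz => ?_)
  · have : z i - z j ≤ 1 := hz.2
    simp [kfun, this]
  · have h1 : 1 ≤ z i - z j := hz.2
    by_cases h : z i - z j ≤ 1
    · have heq : z i - z j = 1 := le_antisymm h h1
      simp [kfun, heq]
    · simp [kfun, h]

/-- **The bridge representation** `A = [[−1,0] × [0,1], k(s − t)]`, coordinates `(t, s)`. -/
def bridgeRep : IntegralRep 2 where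
  domain := rectTS
  integrand z := kfun (z 1 - z 0)
  isSemialgebraic_domain := isSemialgebraic_rectTS
  isSemialgebraicFunOn_integrand := isSemialgebraicFunOn_kfun_comp isSemialgebraic_rectTS 1 0
  integrableOn := by
    have h : rectTS = Icc ![(-1:ℝ), 0] ![0, 1] := by
      ext z
      simp only [rectTS, mem_setOf_eq, mem_Icc, Pi.le_def, Fin.forall_fin_two, Matrix.cons_val_zero,
        Matrix.cons_val_one]
      tauto
    refine ContinuousOn.integrableOn_compact (h ▸ isCompact_Icc) ?_
    exact (continuous_kfun.comp ((continuous_apply 1).sub (continuous_apply 0))).continuousOn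

/-- `Fin.init` on `ℝ²` keeps the first coordinate. -/
theorem init_fin_two (z : Fin 2 → ℝ) : (Fin.init z : Fin 1 → ℝ) 0 = z 0 := rfl

/-- First coordinate of `Fin.snoc x s : ℝ²`. -/
theorem snoc_fin_one_zero (x : Fin 1 → ℝ) (s : ℝ) : (Fin.snoc x s : Fin 2 → ℝ) 0 = x 0 := by
  have : (0 : Fin 2) = Fin.castSucc (0 : Fin 1) := rfl
  rw [this, Fin.snoc_castSucc]

/-- Last coordinate of `Fin.snoc x s : ℝ²`. -/
theorem snoc_fin_one_one (x : Fin 1 → ℝ) (s : ℝ) : (Fin.snoc x s : Fin 2 → ℝ) 1 = s := by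
  have : (1 : Fin 2) = Fin.last 1 := rfl
  rw [this, Fin.snoc_last]

/-- **Move 1 (Newton–Leibniz in `s`)**: `[A] − [[−1,0], 1/(1+t²)]` is ONE rule-3 move, primitive
`K(s − t)`, edges `0 ≤ 1`, boundary `K(1−t) − K(−t) = 1/(1+t²)`. -/
theorem of_bridgeRep_sub_mem_newtonLeibnizRel :
    of bridgeRep - of (arctanRep (-1) 0) ∈ newtonLeibnizRel := by
  refine ⟨1, bridgeRep, arctanRep (-1) 0, fun _ => 0, fun _ => 1, fun z => Kfun (z 1 - z 0),
    isSemialgebraicFunOn_Kfun_comp isSemialgebraic_rectTS 1 0, ?_, ?_, fun _ _ => zero_le_one, ?_, ?_, ?_, ?_, rfl⟩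
  · exact (isSemialgebraicFunOn_ratCast (arctanRep (-1) 0).isSemialgebraic_domain 0).congr fun _ _ => by simp
  · exact (isSemialgebraicFunOn_ratCast (arctanRep (-1) 0).isSemialgebraic_domain 1).congr fun _ _ => by simp
  · ext z
    simp only [bridgeRep, rectTS, arctanRep_domain, mem_setOf_eq, mem_Icc, Rat.cast_neg, Rat.cast_one,
      Rat.cast_zero, init_fin_two]
    rfl
  · intro x _
    simp only [snoc_fin_one_zero, snoc_fin_one_one]
    exact (continuous_Kfun.comp (continuous_id.sub continuous_const)).continuousOn
  · intro x _ s _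
    simp only [bridgeRep, snoc_fin_one_zero, snoc_fin_one_one]
    have h := (hasDerivAt_Kfun (s - x 0)).comp s ((hasDerivAt_id s).sub_const (x 0))
    rw [mul_one] at h
    exact h
  · intro x hx
    rw [arctanRep_integrand]
    simp only [snoc_fin_one_zero, snoc_fin_one_one]
    have hx' : x 0 ∈ Icc (-1:ℝ) 0 := by simpa [arctanRep_domain] using hx
    have h := Kfun_add_one_sub (-x 0) (by linarith [hx'.2]) (by linarith [hx'.1])
    have e1 : (1:ℝ) - x 0 = -x 0 + 1 := by ring
    have e2 : (0:ℝ) - x 0 = -x 0 := by ring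
    rw [e1, e2, h]
    ring

/-- The transposed bridge `B = A.reindex swap = [[0,1] × [−1,0], k(s − t)]`, coordinates `(s, t)`. -/
def bridgeRepSwap : IntegralRep 2 := bridgeRep.reindex (Equiv.swap 0 1)

/-- The domain of the transposed bridge is `[0,1] × [−1,0]` (coordinates `(s,t)`). -/
theorem bridgeRepSwap_domain :
    bridgeRepSwap.domain = {w : Fin 2 → ℝ | w 1 ∈ Icc (-1:ℝ) 0 ∧ w 0 ∈ Icc (0:ℝ) 1} := by
  ext w
  simp [bridgeRepSwap, IntegralRep.reindex_domain, bridgeRep, rectTS, Equiv.swap_apply_left,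
    Equiv.swap_apply_right]

/-- The integrand of the transposed bridge is `k(s − t)`. -/
theorem bridgeRepSwap_integrand (w : Fin 2 → ℝ) : bridgeRepSwap.integrand w = kfun (w 0 - w 1) := by
  simp [bridgeRepSwap, IntegralRep.reindex_integrand, bridgeRep, Equiv.swap_apply_left, Equiv.swap_apply_right]

/-- **Move 3 (Newton–Leibniz in `t`, now the last coordinate)**: `[B] − [[0,1], 1/(1+s²)]` is ONE
rule-3 move, primitive `−K(s − t)`, edges `−1 ≤ 0`, boundary `K(s+1) − K(s) = 1/(1+s²)`. -/
theorem of_bridgeRepSwap_sub_mem_newtonLeibnizRel :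
    of bridgeRepSwap - of (arctanRep 0 1) ∈ newtonLeibnizRel := by
  have hdomS : IsSemialgebraic ℚ bridgeRepSwap.domain := bridgeRepSwap.isSemialgebraic_domain
  refine ⟨1, bridgeRepSwap, arctanRep 0 1, fun _ => -1, fun _ => 0, fun w => -Kfun (w 0 - w 1),
    ?_, ?_, ?_, fun _ _ => by norm_num, ?_, ?_, ?_, ?_, rfl⟩
  · exact (isSemialgebraicFunOn_Kfun_comp hdomS 0 1).neg
  · exact (isSemialgebraicFunOn_ratCast (arctanRep 0 1).isSemialgebraic_domain (-1)).congr fun _ _ => by simp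
  · exact (isSemialgebraicFunOn_ratCast (arctanRep 0 1).isSemialgebraic_domain 0).congr fun _ _ => by simp
  · ext w
    simp only [bridgeRepSwap_domain, arctanRep_domain, mem_setOf_eq, mem_Icc, Rat.cast_zero, Rat.cast_one,
      init_fin_two]
    constructor
    · rintro ⟨⟨h1, h2⟩, h3⟩; exact ⟨h3, h1, h2⟩
    · rintro ⟨h3, h1, h2⟩; exact ⟨⟨h1, h2⟩, h3⟩
  · intro x _
    simp only [snoc_fin_one_zero, snoc_fin_one_one]
    exact (continuous_Kfun.comp (continuous_const.sub continuous_id)).neg.continuousOn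
  · intro x _ t _
    rw [bridgeRepSwap_integrand]
    simp only [snoc_fin_one_zero, snoc_fin_one_one]
    have h := (hasDerivAt_Kfun (x 0 - t)).comp t ((hasDerivAt_const t (x 0)).sub (hasDerivAt_id t))
    have h' := h.neg
    have e : -(kfun (x 0 - t) * (0 - 1)) = kfun (x 0 - t) := by ring
    rw [e] at h'
    exact h'
  · intro x hx
    rw [arctanRep_integrand]
    simp only [snoc_fin_one_zero, snoc_fin_one_one]
    have hx' : x 0 ∈ Icc (0:ℝ) 1 := by simpa [arctanRep_domain] using hx
    have h := Kfun_add_one_sub (x 0) hx'.1 hx'.2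
    have e1 : x 0 - (0:ℝ) = x 0 := by ring
    have e2 : x 0 - (-1:ℝ) = x 0 + 1 := by ring
    rw [e1, e2, ← h]
    ring

/-- **Move 2 (ONE transposition)**: `[A] − [B]` is a single change-of-variables move along the
coordinate swap (linear, `|det| = 1`; the instance of `KZ.of_sub_of_reindex_mem_relations`). -/
theorem of_bridgeRep_sub_swap_mem_changeOfVariablesRel :
    of bridgeRep - of bridgeRepSwap ∈ changeOfVariablesRel := by
  let e : Fin 2 ≃ Fin 2 := Equiv.swap 0 1
  let M : Matrix (Fin 2) (Fin 2) ℝ := (1 : Matrix (Fin 2) (Fin 2) ℝ).submatrix e.symm (Equiv.refl _)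
  let L : (Fin 2 → ℝ) →L[ℝ] (Fin 2 → ℝ) := LinearMap.toContinuousLinearMap (Matrix.toLin' M)
  have hL : ∀ z : Fin 2 → ℝ, L z = fun j => z (e.symm j) := by
    intro z
    change Matrix.toLin' M z = _
    rw [Matrix.toLin'_apply, Matrix.submatrix_mulVec_equiv, Matrix.one_mulVec]
    rfl
  have hdet : |L.det| = 1 := by
    change |LinearMap.det (Matrix.toLin' M)| = 1
    rw [LinearMap.det_toLin', Matrix.abs_det_submatrix_equiv_equiv, Matrix.det_one, abs_one]
  refine ⟨2, bridgeRep, bridgeRepSwap, fun z => fun j => z (e.symm j), fun _ => L, ?_, ?_, ?_, ?_, ?_, rfl⟩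
  · convert isSemialgebraicMapOn_aeval bridgeRep.isSemialgebraic_domain
      (fun j => (MvPolynomial.X (e.symm j) : MvPolynomial (Fin 2) ℚ)) using 2 with z
    ext j; simp
  · intro z _
    have h := L.hasFDerivWithinAt (s := bridgeRep.domain) (x := z)
    convert h using 1
    ext z' j
    rw [hL]
  · intro z₁ _ z₂ _ h
    ext i
    have := congrFun h (e i)
    simpa [e] using this
  · ext w
    simp only [bridgeRepSwap, IntegralRep.reindex_domain, mem_setOf_eq, mem_image]
    constructor
    · intro hw
      exact ⟨fun i => w (e i), hw, by ext j; simp [e]⟩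
    · rintro ⟨z, hz, rfl⟩
      simpa [e] using hz
  · intro z _
    rw [hdet, mul_one]
    simp [bridgeRepSwap, IntegralRep.reindex_integrand, e]

/-- **Three moves reconnect the no-rule-2 witness**: `[[−1,0], f] − [[0,1], f]`, `f = 1/(1+t²)`,
lies in the subgroup generated by rule 3) together with the SINGLE transposition instance
`[A] − [B]` (so `Λcov` dies under one coordinate permutation, and the pair is KZ-equivalent).
Identity: `r₋ − r₊ = −(A − r₋) + (A − B) + (B − r₊)`. -/
theorem arctan_pair_mem_closure_nl_swap :
    of (arctanRep (-1) 0) - of (arctanRep 0 1) ∈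
      AddSubgroup.closure (newtonLeibnizRel ∪ {of bridgeRep - of bridgeRepSwap}) := by
  set S := AddSubgroup.closure (newtonLeibnizRel ∪ {of bridgeRep - of bridgeRepSwap})
  have e1 : of bridgeRep - of (arctanRep (-1) 0) ∈ S :=
    AddSubgroup.subset_closure (Or.inl of_bridgeRep_sub_mem_newtonLeibnizRel)
  have e2 : of bridgeRep - of bridgeRepSwap ∈ S := AddSubgroup.subset_closure (Or.inr rfl)
  have e3 : of bridgeRepSwap - of (arctanRep 0 1) ∈ S :=
    AddSubgroup.subset_closure (Or.inl of_bridgeRepSwap_sub_mem_newtonLeibnizRel)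
  have : of (arctanRep (-1) 0) - of (arctanRep 0 1) =
      -(of bridgeRep - of (arctanRep (-1) 0)) + (of bridgeRep - of bridgeRepSwap)
        + (of bridgeRepSwap - of (arctanRep 0 1)) := by abel
  rw [this]
  exact S.add_mem (S.add_mem (S.neg_mem e1) e2) e3

end Swap

/-- In particular the two arctangent representations ARE equivalent in the full calculus. -/
theorem arctan_pair_equivalent : Equivalent (arctanRep (-1) 0) (arctanRep 0 1) := by
  refine AddSubgroup.closure_le (K := relations) |>.mpr ?_ arctan_pair_mem_closure_nl_swap
  rintro c (hc | hc)
  · exact newtonLeibnizRel_subset_relations hc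
  · rw [mem_singleton_iff] at hc
    subst hc
    exact changeOfVariablesRel_subset_relations of_bridgeRep_sub_swap_mem_changeOfVariablesRel

end Summit.KontsevichZagierPeriods.HurwitzMicroSectors.NormalFormPrinciple.Negative
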